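import Mathlib

/-!
# The normalisation `vol(K) = 1` of a Haar measure

The printed Hecke-algebra conventions fix a Haar measure with `vol(K) = 1` for a compact open
subgroup `K`.  Mathlib's Haar measures form a cone under positive finite scalars
(`MeasureTheory.Measure.IsHaarMeasure.smul`); this file records that the normalised measure
`(μ K)⁻¹ • μ` exists, is a Haar measure with `vol(K) = 1`, and is inversion-invariant when `μ`
is (so the unimodular normalisation of `T5HaarDoubleCosetInverse` is available).
-/

namespace Summit.Ventures.HodgeRepro2.T5HaarNormalisation

open MeasureTheory

variable {G : Type*} [Group G] [TopologicalSpace G] [MeasurableSpace G]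

/-- A compact open subgroup has Haar measure in `(0, ∞)`. -/
theorem measure_ne_zero_ne_top (μ : Measure G) [μ.IsHaarMeasure] {K : Subgroup G}
    (hopen : IsOpen (K : Set G)) (hcpt : IsCompact (K : Set G)) : μ K ≠ 0 ∧ μ K ≠ ⊤ :=
  ⟨(hopen.measure_pos μ ⟨1, K.one_mem⟩).ne', hcpt.measure_lt_top.ne⟩

/-- THE NORMALISED HAAR MEASURE `(μ K)⁻¹ • μ` has `vol(K) = 1`. -/
theorem normalised_apply (μ : Measure G) [μ.IsHaarMeasure] {K : Subgroup G}
    (hopen : IsOpen (K : Set G)) (hcpt : IsCompact (K : Set G)) :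
    ((μ K)⁻¹ • μ) K = 1 := by
  rw [Measure.smul_apply, smul_eq_mul,
    ENNReal.inv_mul_cancel (measure_ne_zero_ne_top μ hopen hcpt).1
      (measure_ne_zero_ne_top μ hopen hcpt).2]

/-- The normalised measure is again a Haar measure. -/
theorem isHaarMeasure_normalised (μ : Measure G) [μ.IsHaarMeasure] {K : Subgroup G}
    (hopen : IsOpen (K : Set G)) (hcpt : IsCompact (K : Set G)) :
    ((μ K)⁻¹ • μ).IsHaarMeasure :=
  Measure.IsHaarMeasure.smul μ (ENNReal.inv_ne_zero.2 (measure_ne_zero_ne_top μ hopen hcpt).2)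
    (ENNReal.inv_ne_top.2 (measure_ne_zero_ne_top μ hopen hcpt).1)

/-- EXISTENCE OF THE NORMALISATION `vol(K) = 1`: for every compact open subgroup `K` of a group
carrying a Haar measure there is a Haar measure `μ'` with `μ'(K) = 1`. -/
theorem exists_isHaarMeasure_measure_eq_one (μ : Measure G) [μ.IsHaarMeasure] {K : Subgroup G}
    (hopen : IsOpen (K : Set G)) (hcpt : IsCompact (K : Set G)) :
    ∃ μ' : Measure G, μ'.IsHaarMeasure ∧ μ' K = 1 :=
  ⟨(μ K)⁻¹ • μ, isHaarMeasure_normalised μ hopen hcpt, normalised_apply μ hopen hcpt⟩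

omit [TopologicalSpace G] in
/-- A positive multiple of an inversion-invariant measure is inversion-invariant. -/
theorem isInvInvariant_smul (μ : Measure G) [μ.IsInvInvariant] (c : ENNReal) :
    (c • μ).IsInvInvariant :=
  ⟨by
    show Measure.map Inv.inv (c • μ) = c • μ
    rw [Measure.map_smul]
    exact congrArg (c • ·) (Measure.map_inv_eq_self μ)⟩

/-- The unimodular normalisation: an inversion-invariant Haar measure with `vol(K) = 1`. -/
theorem exists_isHaarMeasure_isInvInvariant_measure_eq_one (μ : Measure G) [μ.IsHaarMeasure]
    [μ.IsInvInvariant] {K : Subgroup G} (hopen : IsOpen (K : Set G))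
    (hcpt : IsCompact (K : Set G)) :
    ∃ μ' : Measure G, μ'.IsHaarMeasure ∧ μ'.IsInvInvariant ∧ μ' K = 1 :=
  ⟨(μ K)⁻¹ • μ, isHaarMeasure_normalised μ hopen hcpt, isInvInvariant_smul μ _,
    normalised_apply μ hopen hcpt⟩

end Summit.Ventures.HodgeRepro2.T5HaarNormalisation
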